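import Mathlib
import Literature.Combinatorics.Additive.TripleProductProperty
import Literature.Barriers.MatrixMultiplication.NilpotentGroupBarrierMatchings
import Literature.Computability.AlgebraicComplexity.GroupTheoreticMatMulThmBProofs

/-!
# A Neumann-type packing inequality for STPP families

Support file for route `MatrixMultiplication/GroupTheoreticSTPP`, crux `stmt-MatrixMultiplication-0597`,
cell `mm-stpp` (D-0046), CENSUS-PLAN §6 kill criterion K-F3 (b) (memo `HOME/mm-stpp-eng-1/F3-PACKING-BOUND.md`).

**Theorem A.** Let `(A i, B i, C i)_{i : ι}` be an STPP family (Cohn–Kleinberg–Szegedy–Umans 2005,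
Def. 5.1; tree `SimultaneousTPP`) in a finite group `G` with all `A i`, `B i` non-empty, and let `m`
bound every `|C i|`. Then
`∑ i, |C i| · (|A i| + |B i|) ≤ |G| + m`
(`stpp_neumann_packing`, additive `add_stpp_neumann_packing`), and the two cyclic rotations
(`stpp_neumann_packing₂/₃`).  For one triple (`ι = Unit`) this is
P. M. Neumann's inequality `|U|(|S| + |T| − 1) ≤ |G|` (LMS J. Comput. Math. 14 (2011), Obs. 3.1; tree
`TripleProductProperty.card_mul_le_neumann`); for `k` triples of the uniform shape `(s,s,s)` it reads
`s (2ks − 1) ≤ |G|` (`stpp_neumann_packing_uniform`, census form `isSTPP_neumann_packing_uniform`), i.e. `k ≤ (|G| + s)/(2s²)` — half of the disjointness packing bound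
`k s² ≤ |G|` (Blasiak et al. 2017 §2; tree `SimultaneousTPP.sum_card_mul_card_le`).

Proof (double counting).  With `P_i = C_i⁻¹A_i`, `Q_i = A_i⁻¹B_i`, `R_i = B_i⁻¹C_i`, clause (ii) of
Def. 5.1, conjugated, says that `p q r = 1` with `p ∈ P_k, q ∈ Q_i, r ∈ R_j` forces `k = i = j` and then
(clause (i)) the trivial solution.  Count the pairs `(q, r) ∈ Q × R` (as pairs of index-tagged pairs):
those with `(qr)⁻¹ ∈ P` inject into `⨆ i, A i × B i × C i` (at most `m · ∑|A i||B i|` of them), the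
others inject into `(⨆ i, A i × B i) × (G ∖ P⁻¹)`.  Dividing by `∑ |A i||B i| > 0` gives
`∑|B i||C i| + ∑|C i||A i| ≤ |G| + m`.

Consequences recorded in the memo (not formalized here): no STPP family of `k ≥ 4` triples of shape
`(3,3,3)` in any group of order `64`, of `k ≥ 5` triples of shape `(4,4,4)` in any group of order `125`
(`isSTPP_card_le_three_of_order64`, `isSTPP_card_le_four_of_order125` below are the two numeric
instances used by K-F3 (b); the boundary case `k = 4` in `ℤ₅³` — "Theorem B" of the memo — is a separate
hand proof, not formalized here).

WHAT THIS IS NOT: a packing obstruction only; no `ω` statement; nothing about which `k ≤ (|G|+s)/(2s²)`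
are realised.

## References
* P. M. Neumann, *A note on the triple product property for subsets of finite groups*, LMS J. Comput.
  Math. 14 (2011) 232–237, Observation 3.1 (the case of one triple).
* H. Cohn, R. Kleinberg, B. Szegedy, C. Umans, FOCS 2005, Def. 5.1 (STPP).
* J. Blasiak, T. Church, H. Cohn, J. A. Grochow, E. Naslund, W. F. Sawin, C. Umans, Discrete Analysis
  2017:3, §2 (packing bound).
-/

-- single-conjunct summit: the mandated namespace repeats `MatrixMultiplication`.
set_option linter.dupNamespace false

namespace Summit.MatrixMultiplication.MatrixMultiplication.Theorems

namespace STPPNeumannPacking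

open Finset Literature.Combinatorics.Additive

variable {G : Type*} [Group G] {ι : Type*} {A B C : ι → Finset G}

/-- The conjugated form of CKSU Def. 5.1: if `(c'⁻¹ a') (a⁻¹ b) (b'⁻¹ c) = 1` with `a', c'` from triple
`k`, `a, b` from triple `i` and `b', c` from triple `j` of an STPP family, then `k = i = j` and the
solution is trivial (`a' = a`, `b = b'`, `c = c'`). [cite: CohnKleinbergSzegedyUmans2005, Def. 5.1] -/
@[to_additive addCollapse /-- Additive form of `collapse`: if `(-c' + a') + (-a + b) + (-b' + c) = 0` with the
memberships of `collapse`, then `k = i = j` and `a' = a`, `b = b'`, `c = c'`.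
(Reference as for the multiplicative version: CohnKleinbergSzegedyUmans2005, Def. 5.1.) -/]
theorem collapse (h : SimultaneousTPP A B C) {i j k : ι} {a a' b b' c c' : G} (ha' : a' ∈ A k)
    (hc' : c' ∈ C k) (ha : a ∈ A i) (hb : b ∈ B i) (hb' : b' ∈ B j) (hc : c ∈ C j)
    (he : c'⁻¹ * a' * (a⁻¹ * b) * (b'⁻¹ * c) = 1) :
    k = i ∧ i = j ∧ a' = a ∧ b = b' ∧ c = c' := by
  have he6 : a' * a⁻¹ * b * b'⁻¹ * c * c'⁻¹ = 1 := by
    calc a' * a⁻¹ * b * b'⁻¹ * c * c'⁻¹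
        = c' * (c'⁻¹ * a' * (a⁻¹ * b) * (b'⁻¹ * c)) * c'⁻¹ := by group
      _ = 1 := by rw [he]; group
  obtain ⟨hki, hij⟩ := h.2 k i j a' ha' a ha b hb b' hb' c hc c' hc' he6
  subst hki; subst hij
  have he6' : a' * a⁻¹ * (b * b'⁻¹) * (c * c'⁻¹) = 1 := by
    simpa only [mul_assoc] using he6
  obtain ⟨h1, h2, h3⟩ := h.1 k a' ha' a ha b hb b' hb' c hc c' hc' he6'
  exact ⟨rfl, rfl, h1, h2, h3⟩

variable [Fintype G] [Fintype ι]

omit [Fintype G] in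
/-- Injectivity of `(k, c, a) ↦ c⁻¹ a` on `⨆ k, C k × A k` (needs the `B k` non-empty).
[cite: BlasiakChurchCohnGrochowNaslundSawinUmans2017, §2] -/
@[to_additive /-- Injectivity of `(k, c, a) ↦ -c + a` on `⨆ k, C k × A k` (needs
the `B k` non-empty). (Reference as for the multiplicative version:
BlasiakChurchCohnGrochowNaslundSawinUmans2017, §2.) -/]
theorem inv_mul_injOn_CA (h : SimultaneousTPP A B C) (hB : ∀ i, (B i).Nonempty) :
    Set.InjOn (fun z : Σ _ : ι, G × G => z.2.1⁻¹ * z.2.2)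
      ↑(univ.sigma fun k => C k ×ˢ A k : Finset (Σ _ : ι, G × G)) := by
  rintro ⟨k, c', a'⟩ hx ⟨k₁, c₁, a₁⟩ hy (he : c'⁻¹ * a' = c₁⁻¹ * a₁)
  simp only [coe_sigma, Set.mem_sigma_iff, coe_univ, Set.mem_univ, true_and, coe_product,
    Set.mem_prod, mem_coe] at hx hy
  obtain ⟨b, hb⟩ := hB k₁
  have key : c'⁻¹ * a' * (a₁⁻¹ * b) * (b⁻¹ * c₁) = 1 := by
    rw [he]; group
  obtain ⟨rfl, -, h1, -, h3⟩ := collapse h hx.2 hx.1 hy.2 hb hb hy.1 key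
  subst h1; subst h3; rfl

omit [Fintype G] in
/-- Injectivity of `(j, b, c) ↦ b⁻¹ c` on `⨆ j, B j × C j` (needs the `A j` non-empty).
[cite: BlasiakChurchCohnGrochowNaslundSawinUmans2017, §2] -/
@[to_additive /-- Injectivity of `(j, b, c) ↦ -b + c` on `⨆ j, B j × C j` (needs
the `A j` non-empty). (Reference as for the multiplicative version:
BlasiakChurchCohnGrochowNaslundSawinUmans2017, §2.) -/]
theorem inv_mul_injOn_BC (h : SimultaneousTPP A B C) (hA : ∀ i, (A i).Nonempty) :
    Set.InjOn (fun z : Σ _ : ι, G × G => z.2.1⁻¹ * z.2.2)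
      ↑(univ.sigma fun j => B j ×ˢ C j : Finset (Σ _ : ι, G × G)) := by
  rintro ⟨j, b', c⟩ hx ⟨j₁, b₁, c₁⟩ hy (he : b'⁻¹ * c = b₁⁻¹ * c₁)
  simp only [coe_sigma, Set.mem_sigma_iff, coe_univ, Set.mem_univ, true_and, coe_product,
    Set.mem_prod, mem_coe] at hx hy
  obtain ⟨a, ha⟩ := hA j₁
  -- `(c₁⁻¹ a)(a⁻¹ b₁)(b'⁻¹ c) = 1`
  have key : c₁⁻¹ * a * (a⁻¹ * b₁) * (b'⁻¹ * c) = 1 := by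
    rw [he]; group
  obtain ⟨-, rfl, -, h2, h3⟩ := collapse h ha hy.2 ha hy.1 hx.1 hx.2 key
  subst h2; subst h3; rfl

omit [Group G] [Fintype G] in
/-- `|⨆ i, X i × Y i| = ∑ i, |X i| |Y i|`. [folklore] -/
theorem card_sigma_product (X Y : ι → Finset G) :
    (univ.sigma fun i => X i ×ˢ Y i).card = ∑ i, (X i).card * (Y i).card := by
  rw [card_sigma]; simp only [card_product]

/-- **Theorem A (Neumann-type packing inequality for STPP families).** For an STPP family in a
finite group `G` with all `A i`, `B i` non-empty and any `m` with `|C i| ≤ m` for all `i`: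
`∑ i, |C i| (|A i| + |B i|) ≤ |G| + m`.  (One triple: Neumann 2011, Obs. 3.1.) [original] -/
@[to_additive add_stpp_neumann_packing /-- **Theorem A, additive form.** For an (additive) STPP
family in a finite additive group `G` with all `A i`, `B i` non-empty and `|C i| ≤ m` for all `i`:
`∑ i, |C i| (|A i| + |B i|) ≤ |G| + m`. [original] -/]
theorem stpp_neumann_packing (h : SimultaneousTPP A B C) (hA : ∀ i, (A i).Nonempty)
    (hB : ∀ i, (B i).Nonempty) {m : ℕ} (hm : ∀ i, (C i).card ≤ m) :
    ∑ i, (C i).card * ((A i).card + (B i).card) ≤ Fintype.card G + m := by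
  classical
  rcases isEmpty_or_nonempty ι with hι | hne
  · simp [Finset.univ_eq_empty]
  obtain ⟨i₀⟩ := hne
  -- the three tagged domains, the quotient map and the inverted `P`-set
  set QD : Finset (Σ _ : ι, G × G) := univ.sigma fun i => A i ×ˢ B i with hQD
  set RD : Finset (Σ _ : ι, G × G) := univ.sigma fun j => B j ×ˢ C j with hRD
  set PD : Finset (Σ _ : ι, G × G) := univ.sigma fun k => C k ×ˢ A k with hPD
  set quo : (Σ _ : ι, G × G) → G := fun z => z.2.1⁻¹ * z.2.2 with hquo
  set Pinv : Finset G := PD.image fun z => (quo z)⁻¹ with hPinv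
  have hPinv_card : Pinv.card = PD.card := by
    rw [hPinv]
    refine card_image_of_injOn ?_
    intro z hz z' hz' (he : (quo z)⁻¹ = (quo z')⁻¹)
    exact inv_mul_injOn_CA h hB hz hz' (inv_injective he)
  -- the pairs `(q, r)`
  set X := QD ×ˢ RD with hX
  set φ : (Σ _ : ι, G × G) × (Σ _ : ι, G × G) → G := fun x => quo x.1 * quo x.2 with hφ
  set X₁ := X.filter fun x => φ x ∈ Pinv with hX₁
  set X₂ := X.filter fun x => φ x ∉ Pinv with hX₂
  have hsplit : X₁.card + X₂.card = X.card := card_filter_add_card_filter_not _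
  -- the conjugated CKSU relation extracted from `φ x ∈ Pinv`
  have hrel : ∀ x ∈ X, ∀ z ∈ PD, (quo z)⁻¹ = φ x →
      z.1 = x.1.1 ∧ x.1.1 = x.2.1 ∧ z.2.2 = x.1.2.1 ∧ x.1.2.2 = x.2.2.1 ∧ x.2.2.2 = z.2.1 := by
    intro x hx z hz hzφ
    rw [hX, mem_product, hQD, hRD] at hx
    rw [hPD] at hz
    simp only [mem_sigma, mem_univ, true_and, mem_product] at hx hz
    have key : (z.2.1)⁻¹ * z.2.2 * ((x.1.2.1)⁻¹ * x.1.2.2) * ((x.2.2.1)⁻¹ * x.2.2.2) = 1 := by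
      have : quo z * φ x = 1 := by rw [← hzφ]; exact mul_inv_cancel _
      simpa only [hquo, hφ, mul_assoc] using this
    exact collapse h hz.2 hz.1 hx.1.1 hx.1.2 hx.2.1 hx.2.2 key
  -- (1) `X₁` injects into `⨆ i, (A i × B i) × C i`
  set T : Finset (Σ _ : ι, (G × G) × G) := univ.sigma fun i => (A i ×ˢ B i) ×ˢ C i with hT
  have hX₁ : X₁.card ≤ T.card := by
    refine card_le_card_of_injOn (fun x => ⟨x.1.1, (x.1.2, x.2.2.2)⟩) ?_ ?_
    · intro x hx
      rw [hX₁, mem_coe, mem_filter] at hx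
      obtain ⟨hxX, hφx⟩ := hx
      rw [hPinv, mem_image] at hφx
      obtain ⟨z, hz, hzφ⟩ := hφx
      obtain ⟨-, h2, -, -, h5⟩ := hrel x hxX z hz hzφ
      rw [hX, mem_product, hQD, hRD] at hxX
      simp only [mem_sigma, mem_univ, true_and, mem_product] at hxX
      simp only [hT, coe_sigma, Set.mem_sigma_iff, coe_univ, Set.mem_univ, true_and, coe_product,
        Set.mem_prod, mem_coe]
      refine ⟨⟨hxX.1.1, hxX.1.2⟩, ?_⟩
      rw [h2]; exact hxX.2.2
    · intro x hx y hy hxy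
      rw [hX₁, mem_coe, mem_filter] at hx hy
      obtain ⟨hxX, hφx⟩ := hx
      obtain ⟨hyX, hφy⟩ := hy
      rw [hPinv, mem_image] at hφx hφy
      obtain ⟨z, hz, hzφ⟩ := hφx
      obtain ⟨z', hz', hzφ'⟩ := hφy
      obtain ⟨-, hij, -, hbb, -⟩ := hrel x hxX z hz hzφ
      obtain ⟨-, hij', -, hbb', -⟩ := hrel y hyX z' hz' hzφ'
      -- read off the components of `hxy`
      simp only [Sigma.mk.injEq] at hxy
      obtain ⟨hi, hrest⟩ := hxy
      obtain ⟨⟨i, a, b⟩, ⟨j, b', c⟩⟩ := x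
      obtain ⟨⟨i', a₁, b₁⟩, ⟨j', b₁', c₁⟩⟩ := y
      simp only at hi hij hij' hbb hbb' hrest ⊢
      subst hi
      simp only [heq_eq_eq, Prod.mk.injEq] at hrest
      obtain ⟨⟨rfl, rfl⟩, rfl⟩ := hrest
      subst hij; subst hij'; subst hbb; subst hbb'
      rfl
  have hT_card : T.card = ∑ i, (A i).card * (B i).card * (C i).card := by
    rw [hT, card_sigma]; simp only [card_product]
  have hX₁' : X₁.card ≤ m * QD.card := by
    calc X₁.card ≤ T.card := hX₁
      _ = ∑ i, (A i).card * (B i).card * (C i).card := hT_card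
      _ ≤ ∑ i, (A i).card * (B i).card * m :=
          sum_le_sum fun i _ => Nat.mul_le_mul_left _ (hm i)
      _ = m * QD.card := by rw [hQD, card_sigma_product, mul_sum]; simp only [mul_comm]
  -- (2) `X₂` injects into `QD × (G ∖ Pinv)`
  have hX₂ : X₂.card ≤ (QD ×ˢ (univ \ Pinv)).card := by
    refine card_le_card_of_injOn (fun x => (x.1, φ x)) ?_ ?_
    · intro x hx
      rw [hX₂, mem_coe, mem_filter, hX, mem_product] at hx
      simp only [coe_product, coe_sdiff, coe_univ, Set.mem_prod, mem_coe, Set.mem_sdiff,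
        Set.mem_univ, true_and]
      exact ⟨hx.1.1, hx.2⟩
    · intro x hx y hy hxy
      rw [hX₂, mem_coe, mem_filter, hX, mem_product] at hx hy
      simp only [Prod.mk.injEq] at hxy
      obtain ⟨h1, h2⟩ := hxy
      have hq2 : quo x.2 = quo y.2 := by
        have : quo x.1 * quo x.2 = quo y.1 * quo y.2 := by simpa only [hφ] using h2
        rw [h1] at this
        exact mul_left_cancel this
      have := inv_mul_injOn_BC h hA (by rw [← hRD]; exact hx.1.2) (by rw [← hRD]; exact hy.1.2)
        (by simpa only [hquo] using hq2)
      exact Prod.ext h1 this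
  have hX₂' : X₂.card ≤ QD.card * (Fintype.card G - Pinv.card) := by
    calc X₂.card ≤ (QD ×ˢ (univ \ Pinv)).card := hX₂
      _ = QD.card * (Fintype.card G - Pinv.card) := by
          rw [card_product, card_univ_sdiff]
  -- assemble
  have hXcard : X.card = QD.card * RD.card := by rw [hX, card_product]
  have hmain : QD.card * RD.card ≤ QD.card * (m + (Fintype.card G - Pinv.card)) := by
    rw [← hXcard, ← hsplit, mul_add, mul_comm QD.card m]
    exact Nat.add_le_add hX₁' hX₂'
  have hQpos : 0 < QD.card := by
    rw [hQD, card_sigma_product]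
    exact Nat.lt_of_lt_of_le (Nat.mul_pos (hA i₀).card_pos (hB i₀).card_pos)
      (single_le_sum (f := fun i => (A i).card * (B i).card) (fun _ _ => Nat.zero_le _)
        (mem_univ i₀))
  have hRle : RD.card ≤ m + (Fintype.card G - Pinv.card) := Nat.le_of_mul_le_mul_left hmain hQpos
  have hPle : Pinv.card ≤ Fintype.card G := card_le_univ _
  have hR : RD.card = ∑ i, (B i).card * (C i).card := by rw [hRD, card_sigma_product]
  have hP : Pinv.card = ∑ i, (C i).card * (A i).card := by rw [hPinv_card, hPD, card_sigma_product]
  have hsum : ∑ i, (C i).card * ((A i).card + (B i).card) = Pinv.card + RD.card := by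
    rw [hR, hP, ← sum_add_distrib]
    refine sum_congr rfl fun i _ => ?_
    ring
  omega

/-- Theorem A, second rotation: `∑ i, |A i| (|B i| + |C i|) ≤ |G| + m` whenever `|A i| ≤ m` and all
`B i`, `C i` are non-empty (apply `stpp_neumann_packing` to the rotated family `(B, C, A)`). [original] -/
theorem stpp_neumann_packing₂ (h : SimultaneousTPP A B C) (hB : ∀ i, (B i).Nonempty)
    (hC : ∀ i, (C i).Nonempty) {m : ℕ} (hm : ∀ i, (A i).card ≤ m) :
    ∑ i, (A i).card * ((B i).card + (C i).card) ≤ Fintype.card G + m :=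
  stpp_neumann_packing h.rotate hB hC hm

/-- Theorem A, third rotation: `∑ i, |B i| (|C i| + |A i|) ≤ |G| + m` whenever `|B i| ≤ m` and all
`C i`, `A i` are non-empty. [original] -/
theorem stpp_neumann_packing₃ (h : SimultaneousTPP A B C) (hC : ∀ i, (C i).Nonempty)
    (hA : ∀ i, (A i).Nonempty) {m : ℕ} (hm : ∀ i, (B i).card ≤ m) :
    ∑ i, (B i).card * ((C i).card + (A i).card) ≤ Fintype.card G + m :=
  stpp_neumann_packing h.rotate.rotate hC hA hm

/-- **Uniform corollary.** `k` STPP triples of shape `(s, s, s)`, `s ≥ 1`, in a finite group `G`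
satisfy `2 k s² ≤ |G| + s`, i.e. `s (2ks − 1) ≤ |G|` — for `k = 1` Neumann's `s(2s − 1) ≤ |G|`; compare
the packing bound `k s² ≤ |G|`. [original] -/
@[to_additive add_stpp_neumann_packing_uniform /-- **Uniform corollary, additive form.** `k` STPP
triples of shape `(s, s, s)`, `s ≥ 1`, in a finite additive group `G` satisfy `2 k s² ≤ |G| + s`.
[original] -/]
theorem stpp_neumann_packing_uniform (h : SimultaneousTPP A B C) {s : ℕ} (hs : 1 ≤ s)
    (hA : ∀ i, (A i).card = s) (hB : ∀ i, (B i).card = s) (hC : ∀ i, (C i).card = s) :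
    2 * Fintype.card ι * s ^ 2 ≤ Fintype.card G + s := by
  have hA' : ∀ i, (A i).Nonempty := fun i => card_pos.1 (by rw [hA i]; exact hs)
  have hB' : ∀ i, (B i).Nonempty := fun i => card_pos.1 (by rw [hB i]; exact hs)
  have := stpp_neumann_packing h hA' hB' (m := s) (fun i => (hC i).le)
  have hrw : ∑ i, (C i).card * ((A i).card + (B i).card) = Fintype.card ι * (s * (s + s)) := by
    rw [Finset.sum_congr rfl fun i _ => by rw [hA i, hB i, hC i], sum_const, card_univ, smul_eq_mul]
  rw [hrw] at this
  calc 2 * Fintype.card ι * s ^ 2 = Fintype.card ι * (s * (s + s)) := by ring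
    _ ≤ Fintype.card G + s := this

end STPPNeumannPacking

/-! ### The census form (`IsSTPP`, abelian hosts) and the two instances used by K-F3 (b) -/

namespace STPPNeumannPacking

open Finset Literature.Combinatorics.Additive Literature.Computability.AlgebraicComplexity

/-- **Theorem A for the census predicate `IsSTPP`** (abelian host, `Fin N`-indexed family): `N` STPP
triples of shape `(s, s, s)`, `s ≥ 1`, satisfy `2 N s² ≤ |H| + s`. [original] -/
theorem isSTPP_neumann_packing_uniform {H : Type*} [AddCommGroup H] [Fintype H] {N : ℕ}
    {A B C : Fin N → Finset H} (h : IsSTPP A B C) {s : ℕ} (hs : 1 ≤ s)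
    (hA : ∀ i, (A i).card = s) (hB : ∀ i, (B i).card = s) (hC : ∀ i, (C i).card = s) :
    2 * N * s ^ 2 ≤ Fintype.card H + s := by
  have h' := (isSTPP_iff_addSimultaneousTPP A B C).1 h
  simpa only [Fintype.card_fin] using add_stpp_neumann_packing_uniform h' hs hA hB hC

/-- **K-F3 (b), order 64.** In an abelian group of order `64` (e.g. `ℤ₄³`) there is no STPP family of
`N ≥ 4` triples of shape `(3, 3, 3)`: `2·N·9 ≤ 67` forces `N ≤ 3`. (Cell mm-stpp, CENSUS-PLAN §6:
the pre-registered bound was `k ≤ 4`; T_A would have needed `k = 5`.) [original] -/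
theorem isSTPP_card_le_three_of_order64 {H : Type*} [AddCommGroup H] [Fintype H]
    (hH : Fintype.card H = 64) {N : ℕ} {A B C : Fin N → Finset H} (h : IsSTPP A B C)
    (hA : ∀ i, (A i).card = 3) (hB : ∀ i, (B i).card = 3) (hC : ∀ i, (C i).card = 3) : N ≤ 3 := by
  have := isSTPP_neumann_packing_uniform h (by norm_num) hA hB hC
  rw [hH] at this
  omega

/-- **K-F3 (b), order 125, the Theorem-A half.** In an abelian group of order `125` (e.g. `ℤ₅³`)
there is no STPP family of `N ≥ 5` triples of shape `(4, 4, 4)`: `2·N·16 ≤ 129` forces `N ≤ 4`.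
(The case `N = 4` in `ℤ₅³` is excluded by the separate boundary argument "Theorem B" of the cell memo,
not formalized here.) [original] -/
theorem isSTPP_card_le_four_of_order125 {H : Type*} [AddCommGroup H] [Fintype H]
    (hH : Fintype.card H = 125) {N : ℕ} {A B C : Fin N → Finset H} (h : IsSTPP A B C)
    (hA : ∀ i, (A i).card = 4) (hB : ∀ i, (B i).card = 4) (hC : ∀ i, (C i).card = 4) : N ≤ 4 := by
  have := isSTPP_neumann_packing_uniform h (by norm_num) hA hB hC
  rw [hH] at this
  omega

end STPPNeumannPacking

end Summit.MatrixMultiplication.MatrixMultiplication.Theorems
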